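import Summits.Ventures.PercRepro.Night2FatXGenericThirteen

/-!
# night-2: generic off-points close `|G| = 12` (`N = 6`) — the level-3 count

At `N = 6` (`m = 5` points of `W ∖ {x}`) the levels `1, 4, 5, 6` are unloaded with generic off-points (level `1`
always, the top three levels by `dload_eq_zero_of_card_sdiff_le_two_of_generic`) and give `175.7/221`; the missing
`0.205` comes from the levels `2, 3`: a free point `y` gives the level-2 target `Q ∪ {x, y}` (`110/221 · 1/5`) and four
unloaded level-3 targets through `x, y` (`4 · (180/221)/15`); all of `W ∖ {x}` on one basis line is the nested
extreme; otherwise the lighter of two basis lines `ℓ₁ ∋ y₁` carries `t₁ ≤ 2` points — at least `4 − (t₁ − 1) ≥ 3`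
unloaded level-3 targets through `y₁` (`card_loaded_targets_through_le`), and when `t₁ = 2` one more, the target
`Q ∪ {x, y₁′, y₂}` with `y₁′` the other point of `ℓ₁` and `y₂` a point off `ℓ₁` (not inside any basis line, hence
unloaded): four unloaded level-3 targets in all, `110/221 + 4 · (180/221)/15 + 175.7/221 − 110/221 = 223.7/221 > 1`
(**`four_le_unloaded_level_three_sum`**, with `dload_eq_zero_of_two_lines_of_generic`: a target through `x` and two
points on different basis lines is unloaded).  The assembly `basis_pair_fair_fat_of_generic_six` and the final
`localShadowHall_fat_of_generic` are in Night2FatXGenericTwelve.  Paper `proofs/NIGHT-2-g33.md` §6 (f).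
-/

namespace PercRepro.Shadow

open PercRepro.ThmH PercRepro.PerFlat

variable {α : Type*} [DecidableEq α] {M : Matroid α} [M.Finite] {G : Finset α}

/-- **A target through `x` and two points on different basis lines (or one off every basis line) is unloaded**
with generic off-points: a distance-1 load has its `Y` inside one basis line. -/
theorem dload_eq_zero_of_two_lines_of_generic (hG : G ∈ flatsQ M (5 + 1)) (hd : (gr M \ G).card = 2)
    (hk : kColoops M G = 1) (hs : ∀ e ∈ gr M, ∀ f ∈ gr M, e ≠ f → rkN M {e, f} = 2)
    (hl : ∀ e ∈ gr M, M.Indep {e}) (hfat : (fatClosures M 5 G 2).card ≤ 1) {B₀ : Finset α}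
    (hB₀ : B₀ ∈ thinMembers M 5 G) {w₀ x : α} (hD : G \ clF M B₀ = {w₀, x})
    (hgen : ∀ R ⊆ G \ coloops M G, rkN M R = 2 → 3 ≤ R.card → 4 ≤ rkN M (insert w₀ (insert x R)))
    {B : Finset α} (hB : B ∈ thinMembers M 5 G) (hnP : ¬ bigP M G B) {z : α} (hz : z ∈ G \ clF M B)
    (hx : x ∉ insert z B) {y₁ y₂ : α} (hy₁ : y₁ ∈ (G \ insert z B).erase x) (hy₂ : y₂ ∈ (G \ insert z B).erase x)
    {a b : α} (ha : a ∈ (insert z B \ coloops M G).erase w₀) (hb : b ∈ (insert z B \ coloops M G).erase w₀)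
    (hab : a ≠ b) (hline : rkN M {a, b, y₁} ≤ 2) (hoff : ¬ rkN M (insert y₂ {a, b}) ≤ 2)
    {T : Finset α} (hT : T ∈ tgtSets M 5 G B z) (hxT : x ∈ T) (hy₁T : y₁ ∈ T) (hy₂T : y₂ ∈ T) :
    dload M 5 G (bigP M G) (dshGT2 M 5 G) T = 0 := by
  by_contra hload
  have hTG : T ⊆ G := subset_G_of_mem_shadowAt (mem_tgtSets.1 hT).1
  obtain ⟨R, hR, hR2, hR3, hcase⟩ := loaded_fat_target_dichotomy hG hd hk hs hl hfat hB₀ hD hTG hload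
  rcases hcase with ⟨hRc, -⟩ | ⟨-, hcop⟩
  · obtain ⟨a', ha', b', hb', hab', hrk⟩ :=
      exists_basis_line_of_dist_one_fat hG hd hk hs hB hnP hz hT hxT hx hR hR2 hRc
    have hy₁Y : y₁ ∈ (T \ insert z B).erase x :=
      Finset.mem_erase.2 ⟨(Finset.mem_erase.1 hy₁).1,
        Finset.mem_sdiff.2 ⟨hy₁T, (Finset.mem_sdiff.1 (Finset.mem_of_mem_erase hy₁)).2⟩⟩
    have hy₂Y : y₂ ∈ (T \ insert z B).erase x :=
      Finset.mem_erase.2 ⟨(Finset.mem_erase.1 hy₂).1,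
        Finset.mem_sdiff.2 ⟨hy₂T, (Finset.mem_sdiff.1 (Finset.mem_of_mem_erase hy₂)).2⟩⟩
    have hsub₁ : ({a', b', y₁} : Finset α) ⊆ insert a' (insert b' ((T \ insert z B).erase x)) := by
      intro e he
      rw [Finset.mem_insert, Finset.mem_insert, Finset.mem_singleton] at he
      rw [Finset.mem_insert, Finset.mem_insert]
      rcases he with rfl | rfl | rfl
      · exact Or.inl rfl
      · exact Or.inr (Or.inl rfl)
      · exact Or.inr (Or.inr hy₁Y)
    have hrk₁ : rkN M {a', b', y₁} ≤ 2 := by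
      have := rkN_mono (M := M) hsub₁
      rw [hrk] at this
      exact this
    have hsame : ({a, b} : Finset α) = {a', b'} := by
      by_contra hne
      exact not_on_two_basis_lines hG hd hk hs hl hB hnP hz (Finset.mem_of_mem_erase ha)
        (Finset.mem_of_mem_erase hb) (Finset.mem_of_mem_erase ha') (Finset.mem_of_mem_erase hb') hab hab' hne
        (Finset.mem_of_mem_erase hy₁) hline hrk₁
    apply hoff
    have hsub₂ : insert y₂ {a, b} ⊆ insert a' (insert b' ((T \ insert z B).erase x)) := by
      intro u hu
      rw [Finset.mem_insert] at hu
      rcases hu with rfl | hu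
      · exact Finset.mem_insert_of_mem (Finset.mem_insert_of_mem hy₂Y)
      · rw [hsame, Finset.mem_insert, Finset.mem_singleton] at hu
        rw [Finset.mem_insert, Finset.mem_insert]
        rcases hu with rfl | rfl
        · exact Or.inl rfl
        · exact Or.inr (Or.inl rfl)
    have := rkN_mono (M := M) hsub₂
    rw [hrk] at this
    exact this
  · have hRV : R ⊆ G \ coloops M G := fun r hr =>
      Finset.sdiff_subset_sdiff hTG (Finset.Subset.refl _) (Finset.mem_sdiff.1 (hR hr)).1
    have := hgen R hRV hR2 hR3
    omega


/-- **Four unloaded level-3 targets at `N = 6`** from a point `y₁` of a basis line carrying at most two points of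
`W ∖ {x}` and a point `y₂` off that line: the level-3 sum is at least `4 · fatTerm 3 1`. -/
theorem four_le_unloaded_level_three_sum (hG : G ∈ flatsQ M (5 + 1)) (hd : (gr M \ G).card = 2)
    (hk : kColoops M G = 1) (hs : ∀ e ∈ gr M, ∀ f ∈ gr M, e ≠ f → rkN M {e, f} = 2)
    (hl : ∀ e ∈ gr M, M.Indep {e}) (hfat : (fatClosures M 5 G 2).card ≤ 1) {B₀ : Finset α}
    (hB₀ : B₀ ∈ thinMembers M 5 G) {w₀ x : α} (hD : G \ clF M B₀ = {w₀, x})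
    (hgen : ∀ R ⊆ G \ coloops M G, rkN M R = 2 → 3 ≤ R.card → 4 ≤ rkN M (insert w₀ (insert x R)))
    {B : Finset α} (hB : B ∈ thinMembers M 5 G) (hnP : ¬ bigP M G B) {z : α} (hz : z ∈ G \ clF M B)
    (hx : x ∈ G \ insert z B) (hN : (G \ insert z B).card = 6) {y₁ : α} (hy₁ : y₁ ∈ (G \ insert z B).erase x)
    {a b : α} (ha : a ∈ (insert z B \ coloops M G).erase w₀) (hb : b ∈ (insert z B \ coloops M G).erase w₀)
    (hab : a ≠ b) (hline : rkN M {a, b, y₁} ≤ 2)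
    (ht : (((G \ insert z B).erase x).filter (fun y => rkN M (insert y {a, b}) ≤ 2)).card ≤ 2)
    {y₂ : α} (hy₂ : y₂ ∈ (G \ insert z B).erase x) (hoff : ¬ rkN M (insert y₂ {a, b}) ≤ 2) :
    4 * fatTerm 3 1 ≤
      ∑ T ∈ ((tgtSets M 5 G B z).filter
        (fun T => x ∈ T ∧ dload M 5 G (bigP M G) (dshGT2 M 5 G) T = 0)).filter
        (fun T => (T \ insert z B).card = 3),
        capS M 5 G T / ((221 / 360 : ℚ) * ((2 * ((T \ coloops M G).card - 2).choose 4 : ℕ) : ℚ)) := by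
  have hd' : (gr M \ G).card ≤ 5 := by omega
  have hBm : B ∈ membersIn M (Uq M (5 + 2) 5) G := (mem_thinMembers.1 hB).1
  have hy₁x : y₁ ≠ x := (Finset.mem_erase.1 hy₁).1
  have hxQ : x ∉ insert z B := (Finset.mem_sdiff.1 hx).2
  set L := ((G \ insert z B).erase x).filter (fun y => rkN M (insert y {a, b}) ≤ 2) with hL
  have hy₁L : y₁ ∈ L := by
    rw [hL, Finset.mem_filter, insert_pair_eq']
    exact ⟨hy₁, hline⟩
  set F := ((tgtSets M 5 G B z).filter
    (fun T => x ∈ T ∧ dload M 5 G (bigP M G) (dshGT2 M 5 G) T = 0)).filter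
    (fun T => (T \ insert z B).card = 3) with hF
  -- every term of `F` is at least `fatTerm 3 1`
  have hterm : ∀ T ∈ F, fatTerm 3 1 ≤
      capS M 5 G T / ((221 / 360 : ℚ) * ((2 * ((T \ coloops M G).card - 2).choose 4 : ℕ) : ℚ)) := by
    intro T hT
    rw [hF, Finset.mem_filter, Finset.mem_filter] at hT
    obtain ⟨⟨hTt, -, -⟩, hTj⟩ := hT
    have hTK : (T \ coloops M G).card = 3 + 5 := by
      rw [card_sdiff_coloops_eq_level_add_five hG hd hk hB hnP hz hTt, hTj]
    have hGT := card_sdiff_add_card_sdiff_of_mem_tgtSets hTt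
    have hcap : (1 : ℚ) ≤ capS M 5 G T := by
      rw [capS_eq_one_of_card_sdiff_le_three hd (by omega)]
    unfold fatTerm
    rw [hTK]
    apply div_le_div_of_nonneg_right hcap
    positivity
  have hpos : 0 ≤ fatTerm 3 1 := by
    unfold fatTerm
    positivity
  -- the unloaded targets through `x, y₁` at level `3`
  have hX : ({x, y₁} : Finset α) ⊆ G \ insert z B := by
    intro e he
    rw [Finset.mem_insert, Finset.mem_singleton] at he
    rcases he with rfl | rfl
    · exact hx
    · exact Finset.mem_of_mem_erase hy₁
  have hX2 : ({x, y₁} : Finset α).card = 2 := Finset.card_pair hy₁x.symm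
  have hcount := choose_le_card_targets_level hG hB hz hX (by norm_num : 1 ≤ 3) (by rw [hX2]; norm_num)
  rw [hX2, hN] at hcount
  norm_num at hcount
  set A := (tgtSets M 5 G B z).filter (fun T => ({x, y₁} : Finset α) ⊆ T ∧ (T \ insert z B).card = 3) with hA
  have hsplit := Finset.card_filter_add_card_filter_not
    (s := A) (fun T => dload M 5 G (bigP M G) (dshGT2 M 5 G) T = 0)
  have hloaded := card_loaded_targets_through_le hG hd hk hs hl hfat hB₀ hD hgen hB hnP hz hxQ hy₁ ha hb hab hline 3
  rw [← hL] at hloaded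
  have hloadsub : A.filter (fun T => ¬ dload M 5 G (bigP M G) (dshGT2 M 5 G) T = 0) ⊆
      (tgtSets M 5 G B z).filter (fun T => ({x, y₁} : Finset α) ⊆ T ∧ (T \ insert z B).card = 3 ∧
        dload M 5 G (bigP M G) (dshGT2 M 5 G) T ≠ 0) := by
    intro T hT
    rw [Finset.mem_filter, hA, Finset.mem_filter] at hT
    rw [Finset.mem_filter]
    exact ⟨hT.1.1, hT.1.2.1, hT.1.2.2, hT.2⟩
  have hl' := le_trans (Finset.card_le_card hloadsub) hloaded
  have hLe : (L.erase y₁).card + 1 = L.card := by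
    rw [Finset.card_erase_of_mem hy₁L]
    have : 0 < L.card := Finset.card_pos.2 ⟨y₁, hy₁L⟩
    omega
  have hLe1 : (L.erase y₁).card.choose (3 - 2) = (L.erase y₁).card := by
    simp only [show (3 : ℕ) - 2 = 1 from rfl, Nat.choose_one_right]
  rw [hLe1] at hl'
  set U := A.filter (fun T => dload M 5 G (bigP M G) (dshGT2 M 5 G) T = 0) with hU
  have hUsub : U ⊆ F := by
    intro T hT
    rw [hU, Finset.mem_filter, hA, Finset.mem_filter] at hT
    rw [hF, Finset.mem_filter, Finset.mem_filter]
    exact ⟨⟨hT.1.1, hT.1.2.1 (Finset.mem_insert_self _ _), hT.2⟩, hT.1.2.2⟩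
  have hUcard : 5 ≤ U.card + L.card := by omega
  -- the sum over `F` dominates the sum over any sub-family of `F`
  have hsumF : ∀ S ⊆ F, (S.card : ℚ) * fatTerm 3 1 ≤ ∑ T ∈ F,
      capS M 5 G T / ((221 / 360 : ℚ) * ((2 * ((T \ coloops M G).card - 2).choose 4 : ℕ) : ℚ)) := by
    intro S hS
    calc (S.card : ℚ) * fatTerm 3 1 = ∑ _T ∈ S, fatTerm 3 1 := by rw [Finset.sum_const, nsmul_eq_mul]
      _ ≤ ∑ T ∈ S, capS M 5 G T / ((221 / 360 : ℚ) * ((2 * ((T \ coloops M G).card - 2).choose 4 : ℕ) : ℚ)) :=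
          Finset.sum_le_sum (fun T hT => hterm T (hS hT))
      _ ≤ _ := by
          apply Finset.sum_le_sum_of_subset_of_nonneg hS
          intro T _ _
          exact div_nonneg (capS_nonneg' hG hd' T) (by positivity)
  rcases Nat.lt_or_ge L.card 2 with h1 | h2
  · -- `t₁ = 1`: four unloaded targets through `y₁`
    have h4 : (4 : ℚ) ≤ (U.card : ℚ) := by exact_mod_cast (by omega : 4 ≤ U.card)
    calc 4 * fatTerm 3 1 ≤ (U.card : ℚ) * fatTerm 3 1 := mul_le_mul_of_nonneg_right h4 hpos
      _ ≤ _ := hsumF U hUsub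
  · -- `t₁ = 2`: three through `y₁` and the target `Q ∪ {x, y₁′, y₂}`
    have hL2 : L.card = 2 := by omega
    obtain ⟨y₁', hy₁'⟩ : (L.erase y₁).Nonempty := by
      rw [← Finset.card_pos]
      omega
    have hy₁'y₁ : y₁' ≠ y₁ := (Finset.mem_erase.1 hy₁').1
    have hy₁'L : y₁' ∈ L := Finset.mem_of_mem_erase hy₁'
    have hy₁'W : y₁' ∈ (G \ insert z B).erase x := (Finset.mem_filter.1 hy₁'L).1
    have hy₁'line : rkN M {a, b, y₁'} ≤ 2 := by
      have := (Finset.mem_filter.1 hy₁'L).2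
      rwa [insert_pair_eq'] at this
    have hy₂L : y₂ ∉ L := fun h => hoff (Finset.mem_filter.1 h).2
    have hy₂y₁ : y₂ ≠ y₁ := fun h => hy₂L (h ▸ hy₁L)
    have hy₂y₁' : y₂ ≠ y₁' := fun h => hy₂L (h ▸ hy₁'L)
    have hy₁'x : y₁' ≠ x := (Finset.mem_erase.1 hy₁'W).1
    have hy₂x : y₂ ≠ x := (Finset.mem_erase.1 hy₂).1
    set T₀ := insert z B ∪ {x, y₁', y₂} with hT₀
    have hT₀t : T₀ ∈ tgtSets M 5 G B z := by
      rw [tgtSets_eq_image hG hBm hz, Finset.mem_image]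
      refine ⟨{x, y₁', y₂}, Finset.mem_filter.2 ⟨Finset.mem_powerset.2 ?_, ⟨x, Finset.mem_insert_self _ _⟩⟩, rfl⟩
      intro e he
      rw [Finset.mem_insert, Finset.mem_insert, Finset.mem_singleton] at he
      rcases he with rfl | rfl | rfl
      · exact hx
      · exact Finset.mem_of_mem_erase hy₁'W
      · exact Finset.mem_of_mem_erase hy₂
    have hXsub : ({x, y₁', y₂} : Finset α) ⊆ G \ insert z B := by
      intro e he
      rw [Finset.mem_insert, Finset.mem_insert, Finset.mem_singleton] at he
      rcases he with rfl | rfl | rfl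
      · exact hx
      · exact Finset.mem_of_mem_erase hy₁'W
      · exact Finset.mem_of_mem_erase hy₂
    have hT₀sd : T₀ \ insert z B = {x, y₁', y₂} := by
      rw [hT₀, Finset.union_sdiff_left]
      apply Finset.sdiff_eq_self_of_disjoint
      rw [Finset.disjoint_left]
      intro e he
      exact (Finset.mem_sdiff.1 (hXsub he)).2
    have hT₀c : (T₀ \ insert z B).card = 3 := by
      rw [hT₀sd, Finset.card_insert_of_notMem, Finset.card_pair hy₂y₁'.symm]
      rw [Finset.mem_insert, Finset.mem_singleton, not_or]
      exact ⟨hy₁'x.symm, hy₂x.symm⟩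
    have hxT₀ : x ∈ T₀ := Finset.mem_union_right _ (Finset.mem_insert_self _ _)
    have hy₁'T₀ : y₁' ∈ T₀ := Finset.mem_union_right _ (Finset.mem_insert_of_mem (Finset.mem_insert_self _ _))
    have hy₂T₀ : y₂ ∈ T₀ :=
      Finset.mem_union_right _ (Finset.mem_insert_of_mem (Finset.mem_insert_of_mem (Finset.mem_singleton_self _)))
    have hT₀unl : dload M 5 G (bigP M G) (dshGT2 M 5 G) T₀ = 0 :=
      dload_eq_zero_of_two_lines_of_generic hG hd hk hs hl hfat hB₀ hD hgen hB hnP hz hxQ hy₁'W hy₂ ha hb hab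
        hy₁'line hoff hT₀t hxT₀ hy₁'T₀ hy₂T₀
    have hT₀F : T₀ ∈ F := by
      rw [hF, Finset.mem_filter, Finset.mem_filter]
      exact ⟨⟨hT₀t, hxT₀, hT₀unl⟩, hT₀c⟩
    have hT₀U : T₀ ∉ U := by
      intro h
      rw [hU, Finset.mem_filter, hA, Finset.mem_filter] at h
      have hy₁T₀ : y₁ ∈ T₀ := h.1.2.1 (Finset.mem_insert_of_mem (Finset.mem_singleton_self _))
      have hy₁Q : y₁ ∉ insert z B := (Finset.mem_sdiff.1 (Finset.mem_of_mem_erase hy₁)).2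
      rw [hT₀, Finset.mem_union] at hy₁T₀
      rcases hy₁T₀ with h' | h'
      · exact hy₁Q h'
      · rw [Finset.mem_insert, Finset.mem_insert, Finset.mem_singleton] at h'
        rcases h' with h' | h' | h'
        · exact hy₁x h'
        · exact hy₁'y₁ h'.symm
        · exact hy₂y₁ h'.symm
    have hcard : 4 ≤ (insert T₀ U).card := by
      rw [Finset.card_insert_of_notMem hT₀U]
      omega
    have h4 : (4 : ℚ) ≤ ((insert T₀ U).card : ℚ) := by exact_mod_cast hcard
    calc 4 * fatTerm 3 1 ≤ ((insert T₀ U).card : ℚ) * fatTerm 3 1 := mul_le_mul_of_nonneg_right h4 hpos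
      _ ≤ _ := hsumF (insert T₀ U) (Finset.insert_subset hT₀F hUsub)

end PercRepro.Shadow
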